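import Summits.ABC.IUTFork.Repair.CandInternal2RealHex
import Summits.ABC.IUTFork.Repair.CandInternal2RealSharp
import HarnessLib

/-!
# IUT REPAIR BRANCH (rung LADDER-ABC:A2.RP → A2.RESCUE-H), class (i) INTERNAL, seat rp-d2 — `CandInternal2RealGap`: the NORM SPECTRUM of
# `log_p(𝒪_K^×)` has GAPS below the inner radius — a VALUATION-ONLY decider for the «OPEN-shape» I06⋆ cells

PROOF-ONLY file (D-0012; 0 definitions, 0 `Prop` facts) of the abc-iut cell, IUT REPAIR branch; seat abc-iut-rp-d2 gen 3 (D-0079 R-H kernel-eval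
hand; CLAIM «GAP-I06STAR-NEG», STATUS 16:59:24Z). TAKES NO SIDE on [IUTchIII] Cor. 3.12 or on any author; classical `p`-adic analysis (Neukirch,
ANT II (5.5)) wired into the R-H cell predicate; inputs ⊆ the frozen FACT-LIST; standard axioms. «refuted as typed» ≠ «refuted in print».

WHY. In `plan/rescue/R-H/I06STAR-COLUMNS.tsv` v2.1 (abc-iut-rh-num-1 16:18:55Z) 189 cells are «OPEN-shape»: the cell's target exponent lies strictly
between the certified INNER radius of the log-shell ([IUTchIV] Prop. 1.2 (i) lower inclusion / the sharp ball `p^a·𝒪 ⊆ log 𝒪^×`) and its SHARP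
OUTER radius (abc-iut-rp-x2 `CandInternal2RealSharp`), so no BALL bound decides them (reading (R1) there). But the set of norms of log-units below
the inner radius is NOT an interval. With `‖1 − y‖ = ‖ϖ‖^s` (`s ≥ 1`) the term of index `n` of `L(y) = −Σ (1−y)ⁿ/n` has exponent `s·n − e·v_p(n)`,
minimal only at prime powers `n = pᵃ` where it is `h_s(a) := s·pᵃ − e·a`; at the TURNING POINT `a₀(s)` (`s·pᵃ(p−1) < e` for `a < a₀`,
`e ≤ s·p^{a₀}(p−1)`) the minimum `φ_e(s) := h_s(a₀)` is unique when the last inequality is strict (a «tie» `s·pᵃ·(p−1) = e` needs `(p−1) ∣ e`), and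
then **`‖L(y)‖ = ‖ϖ‖^{φ_e(s)}` exactly** (abc-iut-w5-d017's `LogSeriesDominantTerm`). Every log-unit is `m⁻¹·L(uᵐ)` with `p ∤ m`, so the norm
spectrum of `log_p(𝒪_K^×) ∖ 0` lies in `{‖ϖ‖^{φ_e(s)} : s tie-free} ∪ {≤ ‖ϖ‖^{φ_e(s)} : s a tie}`; `φ_e` increases with `s`, `φ_e(1)` is rp-x2's
sharp outer edge and `φ_e(s) = s` past `e/(p−1)` (the inner ball); BETWEEN, an exponent `N` in a GAP `φ_e(s₁) < N < φ_e(s₁+1)` with no tie at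
`s ≤ s₁` is not attained — decided by `(p, e, N)` alone.

RESULTS. §1 `norm_logSeries_eq_zpow_of_strict_turning`, `norm_logSeries_le_zpow_of_turning`, `exists_logSeries_of_mem_logUnits`,
`norm_spectrum_logUnits`. §2 **`not_mem_logUnits_of_bracket`** (`‖z‖ = ‖ϖ‖^N`, `h_{s₁}(a₁) < N < h_{s₁+1}(a₂)` at the turning point `a₂` of
`s₁+1`, no tie below `s₁` ⟹ `z ∉ log_p 𝒪_K^×`); tie dischargers `tieFree_of_not_dvd` (`(p−1) ∤ e`), `tieFree_of_bounded`. §3 CELL FORM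
**`not_mem_pow_smul_logShell_of_bracket`** (`‖q‖ = ‖ϖ‖^m`, `N = e·c + m·(1−n)` in a gap ⟹ `q ∉ qⁿ·ℐ_K`, `ℐ_K = (p*)⁻¹·log_p 𝒪_K^×`); root form
`…_root` (`‖q‖^D = p^{−H}`, `m·D = e·H`, odd `p`). §4 R-H ROWS over `ℚ₇` under the LOCAL-TYPE HYPOTHESIS `e(K) = ev·l` (exact `e` is needed — a
hypothesis on the place like R-W's A1, never asserted), `‖q‖ = 7^{−k/l}`, label `j`: **`hex_cell_neg_of_bracket`** (row data `k l ev j s₁ a₁ a₂ A`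
literal), `…_of_not_six_dvd`. The genuine-bed form and the row templates (R-W `λ_k` rows, print's worked datum DH11a1 label 3) are in the
sequel `CandInternal2RealGapRows`.
NUMBERS (my engine, exact integers; `HOME/staging/repair/d2/RH/GAP-BRACKETS-v0.tsv`): of the 189 OPEN-shape cells 157 are NEG-gap (125 distinct
`(e, N)`), 24 ELEMENT-OPEN (`N = φ_e(s)` attained: membership is a residue condition on the specific `q̲`), 8 TIE-OPEN (`42 ∣ e`). READING
(neutral): the «striped» shape of `log_p(𝒪_K^×)` outside its inner ball decides most deep-place cells by valuation alone; it complements the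
U-SHAPE inner-conductor question (abc-iut-w4-d036); nothing here is a verdict on any author's reading of (Ind3). [cite: NeukirchANT1999, Ch. II (5.5)]
[cite: MochizukiAbsTopIII2015, Def 5.4 (iii) p. 126] [cite: Mochizuki2012, IUTchIV Prop. 1.2 (i) p. 10] [claim: Mochizuki2012, status: disputed].
-/

noncomputable section

open NumberField IsDedekindDomain

namespace Summit.ABC.IUTFork.Repair.CandInternal2RealGap

open Set Metric
open scoped Pointwise
open Literature.AnabelianGeometry.AbsoluteAnabelian Literature.IUT.LogThetaLattice Literature.IUT.LogVolume
  Literature.IUT.LogVolume.RamificationCriterion Literature.NumberTheory.GaloisRepresentations.Ultrametric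
  Summit.ABC.IUTFork.Repair.CandInternal2Real Summit.ABC.IUTFork.Repair.CandInternal2RealLabels

section General

variable (p : ℕ) [hp : Fact p.Prime]
variable (K : Type*) [NontriviallyNormedField K] [instK : NormedAlgebra ℚ_[p] K] [IsUltrametricDist K] [ProperSpace K]

/-! ## §1. The norm of `L(y)` over the discrete value group: exact value at a strict turning point, upper bound, reduction, spectrum -/

/-- **EXACT NORM at a strict turning point**: `‖1 − y‖ = ‖ϖ‖ˢ` (`s ≥ 1`), `s·pᵃ·(p−1) < e` for `a < a₀` and `e < s·p^{a₀}·(p−1)` ⟹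
`‖L(y)‖ = ‖ϖ‖^{s·p^{a₀} − e·a₀}` (the term of index `p^{a₀}` strictly dominates every other term). [cite: NeukirchANT1999, Ch. II (5.5)] -/
theorem norm_logSeries_eq_zpow_of_strict_turning {ϖ : Kˣ} (hϖ : IsUniformizer ϖ) {y : K} (hyP : IsPrincipal y)
    {s : ℤ} (hs : 1 ≤ s) (hy : ‖1 - y‖ = ‖(ϖ : K)‖ ^ s) {a₀ : ℕ}
    (hlo : ∀ a < a₀, s * (p : ℤ) ^ a * ((p : ℤ) - 1) < absRamificationIdx p K)
    (hhi : (absRamificationIdx p K : ℤ) < s * (p : ℤ) ^ a₀ * ((p : ℤ) - 1)) :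
    ‖logSeries y‖ = ‖(ϖ : K)‖ ^ (s * (p : ℤ) ^ a₀ - (absRamificationIdx p K : ℤ) * (a₀ : ℤ)) := by
  have hP : (2 : ℤ) ≤ (p : ℤ) := by exact_mod_cast hp.out.two_le
  have hpa0 : 1 ≤ p ^ a₀ := Nat.one_le_pow _ _ hp.out.pos
  refine norm_logSeries_eq_zpow_of_dominant p hϖ hyP hy (p ^ a₀ - 1) ?_ ?_
  · rw [Nat.sub_add_cancel hpa0, padicValNat.prime_pow]
    push_cast
    ring
  · intro n hn
    have hn1 : n + 1 ≠ p ^ a₀ := fun h => hn (by omega)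
    obtain ⟨a, ha, ha'⟩ := exists_exponent_le_index (p := p) hs (absRamificationIdx p K) (Nat.succ_ne_zero n)
    by_cases haa : a = a₀
    · subst haa
      exact ha' hn1
    · exact (exponent_min_strict hs hP hlo hhi haa).trans ha

/-- **UPPER BOUND through a smaller level**: `‖1 − y‖ = ‖ϖ‖ˢ`, `1 ≤ t ≤ s`, `a₀` the turning point of `t` ⟹ `‖L(y)‖ ≤ ‖ϖ‖^{t·p^{a₀} − e·a₀}`
(every term has exponent `≥ h_s(a) ≥ h_t(a) ≥ h_t(a₀)`). [cite: NeukirchANT1999, Ch. II (5.5)] -/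
theorem norm_logSeries_le_zpow_of_turning {ϖ : Kˣ} (hϖ : IsUniformizer ϖ) {y : K}
    {s : ℤ} (hy : ‖1 - y‖ = ‖(ϖ : K)‖ ^ s) {t : ℤ} (ht : 1 ≤ t) (hts : t ≤ s) {a₀ : ℕ}
    (hlo : ∀ a < a₀, t * (p : ℤ) ^ a * ((p : ℤ) - 1) < absRamificationIdx p K)
    (hhi : (absRamificationIdx p K : ℤ) ≤ t * (p : ℤ) ^ a₀ * ((p : ℤ) - 1)) :
    ‖logSeries y‖ ≤ ‖(ϖ : K)‖ ^ (t * (p : ℤ) ^ a₀ - (absRamificationIdx p K : ℤ) * (a₀ : ℤ)) := by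
  have hρ0 : 0 < ‖(ϖ : K)‖ := norm_units_pos ϖ
  have hP : (2 : ℤ) ≤ (p : ℤ) := by exact_mod_cast hp.out.two_le
  refine norm_logSeries_le (zpow_pos hρ0 _).le fun n ↦ ?_
  rw [norm_logTerm_eq_zpow p hϖ hy n]
  refine zpow_le_zpow_right_of_le_one₀ hρ0 hϖ.1.le ?_
  obtain ⟨a, ha, -⟩ := exists_exponent_le_index (p := p) (le_trans ht hts) (absRamificationIdx p K) (Nat.succ_ne_zero n)
  have hpa : (0 : ℤ) ≤ (p : ℤ) ^ a := by positivity
  have h1 : t * (p : ℤ) ^ a - (absRamificationIdx p K : ℤ) * (a : ℤ) ≤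
      s * (p : ℤ) ^ a - (absRamificationIdx p K : ℤ) * (a : ℤ) := by nlinarith
  exact ((exponent_min ht hP hlo hhi a).trans h1).trans ha

include hp instK in
/-- **REDUCTION**: a nonzero log-unit `z = log_p u` has the norm of `L(y)` for the principal unit `y = uᵐ` (`p ∤ m`), and `‖1 − y‖ = ‖ϖ‖ˢ` with
`s ≥ 1`. [cite: NeukirchANT1999, Ch. II (5.5)] -/
theorem exists_logSeries_of_mem_logUnits {ϖ : Kˣ} (hϖ : IsUniformizer ϖ) {z : K} (hz : z ∈ logUnits K) (hz0 : z ≠ 0) :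
    ∃ y : K, IsPrincipal y ∧ ‖z‖ = ‖logSeries y‖ ∧ ∃ s : ℤ, 1 ≤ s ∧ ‖1 - y‖ = ‖(ϖ : K)‖ ^ s := by
  obtain ⟨u, hu, rfl⟩ := mem_logUnits_iff.mp hz
  obtain ⟨m, hm0, hmp, hmP⟩ := exists_pow_isPrincipal_not_dvd (p := p) hu
  have hnorm : ‖unitLog u‖ = ‖logSeries (u ^ m)‖ := by
    rw [unitLog_eq_inv_mul_logSeries p hm0 hmP, norm_mul, norm_inv, norm_natCast_eq_one_of_not_dvd p hmp,
      inv_one, one_mul]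
  have hx : 1 - u ^ m ≠ 0 := by
    intro hx
    have h1 : u ^ m = 1 := (sub_eq_zero.mp hx).symm
    apply hz0
    rw [← norm_eq_zero, hnorm, h1, logSeries_one, norm_zero]
  obtain ⟨s, hs⟩ := hϖ.2 (Units.mk0 (1 - u ^ m) hx)
  rw [Units.val_mk0] at hs
  have hs1 : 1 ≤ s := by
    have h1 : ‖(ϖ : K)‖ ^ s < 1 := hs ▸ hmP
    have := (zpow_lt_one_iff_right_of_lt_one₀ (norm_units_pos ϖ) hϖ.1).mp h1
    omega
  exact ⟨u ^ m, hmP, hnorm, s, hs1, hs⟩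

/-- **THE NORM SPECTRUM OF `log_p(𝒪_K^×)`** (structural form): every nonzero log-unit `z` has a LEVEL `s ≥ 1` such that at the turning point `a₀`
of `s`: `‖z‖ ≤ ‖ϖ‖^{s·p^{a₀} − e·a₀}`, with EQUALITY when the turning inequality is strict (no tie). Below the inner ball the spectrum is the discrete
set `{φ_e(s)}`. [cite: NeukirchANT1999, Ch. II (5.5)] [cite: Mochizuki2012, IUTchIV Prop. 1.2 (i) p. 10] -/
theorem norm_spectrum_logUnits {ϖ : Kˣ} (hϖ : IsUniformizer ϖ) {z : K} (hz : z ∈ logUnits K) (hz0 : z ≠ 0) :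
    ∃ s : ℤ, 1 ≤ s ∧ ∀ a₀ : ℕ, (∀ a < a₀, s * (p : ℤ) ^ a * ((p : ℤ) - 1) < absRamificationIdx p K) →
      ((absRamificationIdx p K : ℤ) ≤ s * (p : ℤ) ^ a₀ * ((p : ℤ) - 1) →
        ‖z‖ ≤ ‖(ϖ : K)‖ ^ (s * (p : ℤ) ^ a₀ - (absRamificationIdx p K : ℤ) * (a₀ : ℤ))) ∧
      ((absRamificationIdx p K : ℤ) < s * (p : ℤ) ^ a₀ * ((p : ℤ) - 1) →
        ‖z‖ = ‖(ϖ : K)‖ ^ (s * (p : ℤ) ^ a₀ - (absRamificationIdx p K : ℤ) * (a₀ : ℤ))) := by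
  obtain ⟨y, hyP, hzy, s, hs1, hy⟩ := exists_logSeries_of_mem_logUnits p K hϖ hz hz0
  refine ⟨s, hs1, fun a₀ hlo => ⟨fun hhi => ?_, fun hhi => ?_⟩⟩
  · rw [hzy]; exact norm_logSeries_le_zpow_of_turning p K hϖ hy hs1 le_rfl hlo hhi
  · rw [hzy]; exact norm_logSeries_eq_zpow_of_strict_turning p K hϖ hyP hs1 hy hlo hhi

/-! ## §2. The GAP test: an exponent strictly between two consecutive levels is not the norm of a log-unit -/

/-- **GAP TEST (bracket form).** `‖z‖ = ‖ϖ‖^N`; `1 ≤ s₁`; `s₁·p^{a₁} − e·a₁ < N` for SOME `a₁` (so `φ_e(s) < N` for every `s ≤ s₁`);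
`a₂` the turning point of `s₁ + 1` with `N < (s₁+1)·p^{a₂} − e·a₂` (so `N < φ_e(s)` for every `s ≥ s₁ + 1`); and NO TIE below `s₁`
(`s·pᵃ·(p−1) ≠ e` for `1 ≤ s ≤ s₁`, all `a`) ⟹ **`z ∉ log_p(𝒪_K^×)`**. [cite: NeukirchANT1999, Ch. II (5.5)] -/
theorem not_mem_logUnits_of_bracket {ϖ : Kˣ} (hϖ : IsUniformizer ϖ) {z : K} {N : ℤ} (hzN : ‖z‖ = ‖(ϖ : K)‖ ^ N)
    {s₁ : ℤ} (hs₁ : 1 ≤ s₁) {a₁ a₂ : ℕ}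
    (hlow : s₁ * (p : ℤ) ^ a₁ - (absRamificationIdx p K : ℤ) * (a₁ : ℤ) < N)
    (hlo₂ : ∀ a < a₂, (s₁ + 1) * (p : ℤ) ^ a * ((p : ℤ) - 1) < absRamificationIdx p K)
    (hhi₂ : (absRamificationIdx p K : ℤ) ≤ (s₁ + 1) * (p : ℤ) ^ a₂ * ((p : ℤ) - 1))
    (hup : N < (s₁ + 1) * (p : ℤ) ^ a₂ - (absRamificationIdx p K : ℤ) * (a₂ : ℤ))
    (htf : ∀ (s : ℤ) (a : ℕ), 1 ≤ s → s ≤ s₁ → s * (p : ℤ) ^ a * ((p : ℤ) - 1) ≠ absRamificationIdx p K) :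
    z ∉ logUnits K := by
  classical
  intro hz
  have hρ0 : 0 < ‖(ϖ : K)‖ := norm_units_pos ϖ
  have hP : (2 : ℤ) ≤ (p : ℤ) := by exact_mod_cast hp.out.two_le
  have hz0 : z ≠ 0 := by
    intro h0
    rw [h0, norm_zero] at hzN
    exact (zpow_pos hρ0 N).ne hzN
  obtain ⟨y, hyP, hzy, s, hs1, hy⟩ := exists_logSeries_of_mem_logUnits p K hϖ hz hz0
  rcases le_or_gt s s₁ with hle | hlt
  · -- level `s ≤ s₁`: tie-free, exact norm `φ_e(s) ≤ h_s(a₁) ≤ h_{s₁}(a₁) < N`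
    obtain ⟨a₀, hlo₀, hhi₀⟩ : ∃ a₀ : ℕ, (∀ a < a₀, s * (p : ℤ) ^ a * ((p : ℤ) - 1) < absRamificationIdx p K) ∧
        (absRamificationIdx p K : ℤ) ≤ s * (p : ℤ) ^ a₀ * ((p : ℤ) - 1) := by
      have hex := exists_le_increment hs1 hP (absRamificationIdx p K)
      exact ⟨Nat.find hex, fun a ha ↦ lt_of_not_ge (Nat.find_min hex ha), Nat.find_spec hex⟩
    have hstrict : (absRamificationIdx p K : ℤ) < s * (p : ℤ) ^ a₀ * ((p : ℤ) - 1) :=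
      lt_of_le_of_ne hhi₀ (fun h => htf s a₀ hs1 hle h.symm)
    have heq := norm_logSeries_eq_zpow_of_strict_turning p K hϖ hyP hs1 hy hlo₀ hstrict
    have h1 := exponent_min hs1 hP hlo₀ hhi₀ a₁
    have hpa : (0 : ℤ) ≤ (p : ℤ) ^ a₁ := by positivity
    have h2 : s * (p : ℤ) ^ a₁ - (absRamificationIdx p K : ℤ) * (a₁ : ℤ) ≤
        s₁ * (p : ℤ) ^ a₁ - (absRamificationIdx p K : ℤ) * (a₁ : ℤ) := by nlinarith
    have hlt' : s * (p : ℤ) ^ a₀ - (absRamificationIdx p K : ℤ) * (a₀ : ℤ) < N := by linarith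
    have hc : ‖(ϖ : K)‖ ^ N < ‖(ϖ : K)‖ ^ (s * (p : ℤ) ^ a₀ - (absRamificationIdx p K : ℤ) * (a₀ : ℤ)) :=
      zpow_lt_zpow_right_of_lt_one₀ hρ0 hϖ.1 hlt'
    rw [← hzN, hzy, heq] at hc
    exact lt_irrefl _ hc
  · -- level `s ≥ s₁ + 1`: `‖z‖ ≤ ‖ϖ‖^{φ_e(s₁+1)} < ‖ϖ‖^N`
    have hle := norm_logSeries_le_zpow_of_turning p K hϖ hy (t := s₁ + 1) (by linarith) (by omega) hlo₂ hhi₂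
    have hc : ‖(ϖ : K)‖ ^ ((s₁ + 1) * (p : ℤ) ^ a₂ - (absRamificationIdx p K : ℤ) * (a₂ : ℤ)) < ‖(ϖ : K)‖ ^ N :=
      zpow_lt_zpow_right_of_lt_one₀ hρ0 hϖ.1 hup
    rw [← hzN, hzy] at hc
    exact absurd (hle.trans_lt hc) (lt_irrefl _)

/-- **No tie when `(p − 1) ∤ e`** (a tie `s·pᵃ·(p−1) = e` makes `p − 1` divide `e`). [cite: NeukirchANT1999, Ch. II (5.5)] -/
theorem tieFree_of_not_dvd (hnd : ¬ (p - 1) ∣ absRamificationIdx p K) (s₁ : ℤ) :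
    ∀ (s : ℤ) (a : ℕ), 1 ≤ s → s ≤ s₁ → s * (p : ℤ) ^ a * ((p : ℤ) - 1) ≠ absRamificationIdx p K := by
  intro s a _ _ h
  apply hnd
  have hp1 : ((p - 1 : ℕ) : ℤ) = (p : ℤ) - 1 := by
    have := hp.out.one_lt.le
    push_cast [Nat.cast_sub this]
    ring
  have hdvd : ((p - 1 : ℕ) : ℤ) ∣ (absRamificationIdx p K : ℤ) := ⟨s * (p : ℤ) ^ a, by rw [hp1, ← h]; ring⟩
  exact_mod_cast hdvd

/-- **Bounded tie check** (for `(p − 1) ∣ e`): if `e < p^A` and `s·pᵃ·(p−1) ≠ e` for all `a < A`, `1 ≤ s ≤ S₁`, then no tie below `S₁`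
(for `a ≥ A`, `s·pᵃ·(p−1) ≥ pᵃ > e`). [cite: NeukirchANT1999, Ch. II (5.5)] -/
theorem tieFree_of_bounded {A S₁ : ℕ} (hA : absRamificationIdx p K < p ^ A)
    (h : ∀ a < A, ∀ s ≤ S₁, 0 < s → s * p ^ a * (p - 1) ≠ absRamificationIdx p K) :
    ∀ (s : ℤ) (a : ℕ), 1 ≤ s → s ≤ (S₁ : ℤ) → s * (p : ℤ) ^ a * ((p : ℤ) - 1) ≠ absRamificationIdx p K := by
  intro s a hs1 hsS heq
  have hp1 : 1 ≤ p := hp.out.one_lt.le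
  obtain ⟨t, rfl⟩ : ∃ t : ℕ, s = (t : ℤ) := ⟨s.toNat, (Int.toNat_of_nonneg (by omega)).symm⟩
  have ht0 : 0 < t := by exact_mod_cast hs1
  have htS : t ≤ S₁ := by exact_mod_cast hsS
  have heqN : t * p ^ a * (p - 1) = absRamificationIdx p K := by
    have : ((t * p ^ a * (p - 1) : ℕ) : ℤ) = (absRamificationIdx p K : ℤ) := by
      push_cast [Nat.cast_sub hp1]
      exact heq
    exact_mod_cast this
  rcases lt_or_ge a A with ha | ha
  · exact h a ha t htS ht0 heqN
  · have h1 : p ^ A ≤ p ^ a := Nat.pow_le_pow_right hp1 ha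
    have h2 : p ^ a ≤ t * p ^ a * (p - 1) := by
      have hp2 : 1 ≤ p - 1 := by have := hp.out.two_le; omega
      calc p ^ a = 1 * p ^ a * 1 := by ring
        _ ≤ t * p ^ a * (p - 1) := by gcongr; omega
    omega

/-! ## §3. The cell form: `q ∉ qⁿ · ℐ_K` when the exponent `e·c + m·(1 − n)` lies in a gap -/

/-- `‖p*‖ = ‖ϖ‖^{e·c}` (`p* = p^c`, `c = 2` for `p = 2`, else `1`). [cite: MochizukiAbsTopIII2015, Def 5.4 (iii) p. 126] -/
theorem norm_pstar_eq_zpow {ϖ : Kˣ} (hϖ : IsUniformizer ϖ) :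
    ‖((p ^ (if p = 2 then 2 else 1) : ℕ) : K)‖ =
      ‖(ϖ : K)‖ ^ ((absRamificationIdx p K : ℤ) * ((if p = 2 then 2 else 1 : ℕ) : ℤ)) := by
  rw [norm_pstarNat_cast, ← norm_pow_absRamificationIdx p K hϖ, ← zpow_natCast, ← zpow_natCast, ← zpow_mul]

/-- **CELL FORM OF THE GAP TEST.** `‖q‖ = ‖ϖ‖ᵐ`; `N = e·c + m·(1 − n)` (the `ϖ`-exponent of `p*·q^{1−n}`) lies in a gap (bracket data as in
`not_mem_logUnits_of_bracket`) ⟹ **`q ∉ qⁿ · ℐ_K`**, `ℐ_K = (p*)⁻¹·log_p(𝒪_K^×)` the real log-shell. For `n = j²` this is the I06⋆ cell at the place.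
[cite: MochizukiAbsTopIII2015, Def 5.4 (iii) p. 126] [claim: Mochizuki2012, status: disputed] -/
theorem not_mem_pow_smul_logShell_of_bracket {ϖ : Kˣ} (hϖ : IsUniformizer ϖ) {q : K} {m : ℤ} (hq : ‖q‖ = ‖(ϖ : K)‖ ^ m)
    {n : ℕ} {N : ℤ} (hN : N = (absRamificationIdx p K : ℤ) * ((if p = 2 then 2 else 1 : ℕ) : ℤ) + m * (1 - (n : ℤ)))
    {s₁ : ℤ} (hs₁ : 1 ≤ s₁) {a₁ a₂ : ℕ}
    (hlow : s₁ * (p : ℤ) ^ a₁ - (absRamificationIdx p K : ℤ) * (a₁ : ℤ) < N)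
    (hlo₂ : ∀ a < a₂, (s₁ + 1) * (p : ℤ) ^ a * ((p : ℤ) - 1) < absRamificationIdx p K)
    (hhi₂ : (absRamificationIdx p K : ℤ) ≤ (s₁ + 1) * (p : ℤ) ^ a₂ * ((p : ℤ) - 1))
    (hup : N < (s₁ + 1) * (p : ℤ) ^ a₂ - (absRamificationIdx p K : ℤ) * (a₂ : ℤ))
    (htf : ∀ (s : ℤ) (a : ℕ), 1 ≤ s → s ≤ s₁ → s * (p : ℤ) ^ a * ((p : ℤ) - 1) ≠ absRamificationIdx p K) :
    q ∉ q ^ n • logShell (PadicLogOnUnits.ofUnitLog p K) := by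
  intro h
  rw [logShell_ofUnitLog] at h
  obtain ⟨ι, hι, hqι⟩ := Set.mem_smul_set.1 h
  obtain ⟨z, hz, rfl⟩ := Set.mem_smul_set.1 hι
  have hρ0 : 0 < ‖(ϖ : K)‖ := norm_units_pos ϖ
  have hρ : ‖(ϖ : K)‖ ≠ 0 := hρ0.ne'
  have hps := norm_pstar_eq_zpow p K hϖ
  set ps : K := ((p ^ (if p = 2 then 2 else 1) : ℕ) : K) with hps_def
  set c : ℕ := (if p = 2 then 2 else 1) with hc_def
  have hps0 : ps ≠ 0 := pstarNat_cast_ne_zero p K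
  simp only [smul_eq_mul] at hqι
  -- norms: ‖q‖^n · ‖p*‖⁻¹ · ‖z‖ = ‖q‖
  have hn := congrArg (fun w : K => ‖w‖) hqι
  simp only [norm_mul, norm_inv, norm_pow, hq, hps] at hn
  have hzN : ‖z‖ = ‖(ϖ : K)‖ ^ N := by
    have h1 : (‖(ϖ : K)‖ ^ m) ^ n = ‖(ϖ : K)‖ ^ (m * n) := by rw [← zpow_natCast, ← zpow_mul]
    rw [h1] at hn
    have h2 : ‖z‖ = ‖(ϖ : K)‖ ^ m * ‖(ϖ : K)‖ ^ ((absRamificationIdx p K : ℤ) * (c : ℤ)) / ‖(ϖ : K)‖ ^ (m * n) := by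
      have hmn : ‖(ϖ : K)‖ ^ (m * n) ≠ 0 := zpow_ne_zero _ hρ
      have hec : ‖(ϖ : K)‖ ^ ((absRamificationIdx p K : ℤ) * (c : ℤ)) ≠ 0 := zpow_ne_zero _ hρ
      field_simp
      field_simp at hn
      linear_combination hn
    rw [h2, hN, ← zpow_add₀ hρ, div_eq_iff (zpow_ne_zero _ hρ), ← zpow_add₀ hρ]
    congr 1
    ring
  exact not_mem_logUnits_of_bracket p K hϖ hzN hs₁ hlow hlo₂ hhi₂ hup htf hz

/-- **ROOT FORM at an odd prime** (the intended Kummer datum is a root: `‖q̲‖^D = p^{−H}`, so `‖q̲‖ = ‖ϖ‖ᵐ` with `m·D = e·H`): with `e = e₀`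
literal and the gap data for `N = e₀ + m·(1 − n)` ⟹ `q̲ ∉ q̲ⁿ · ℐ_K`. [cite: MochizukiAbsTopIII2015, Def 5.4 (iii) p. 126] [claim: Mochizuki2012, status: disputed] -/
theorem not_mem_pow_smul_logShell_of_bracket_root (hp2 : p ≠ 2) {e₀ : ℕ} (he : absRamificationIdx p K = e₀)
    {q : K} {D H m : ℕ} (hD : 0 < D) (hqD : ‖q‖ ^ D = (p : ℝ) ^ (-(H : ℝ))) (hm : m * D = e₀ * H)
    {n : ℕ} {s₁ a₁ a₂ : ℕ} (hs₁ : 1 ≤ s₁)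
    (hlow : (s₁ : ℤ) * (p : ℤ) ^ a₁ - (e₀ : ℤ) * (a₁ : ℤ) < (e₀ : ℤ) + (m : ℤ) * (1 - (n : ℤ)))
    (hlo₂ : ∀ a < a₂, (s₁ + 1) * p ^ a * (p - 1) < e₀) (hhi₂ : e₀ ≤ (s₁ + 1) * p ^ a₂ * (p - 1))
    (hup : (e₀ : ℤ) + (m : ℤ) * (1 - (n : ℤ)) < ((s₁ : ℤ) + 1) * (p : ℤ) ^ a₂ - (e₀ : ℤ) * (a₂ : ℤ))
    (htf : ∀ (s : ℤ) (a : ℕ), 1 ≤ s → s ≤ s₁ → s * (p : ℤ) ^ a * ((p : ℤ) - 1) ≠ e₀) :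
    q ∉ q ^ n • logShell (PadicLogOnUnits.ofUnitLog p K) := by
  obtain ⟨ϖ, hϖ⟩ := exists_isUniformizer (F := K)
  have hp0 : (0 : ℝ) < p := by exact_mod_cast hp.out.pos
  have hp1 : 1 ≤ p := hp.out.one_lt.le
  have he0 : (0 : ℝ) < e₀ := by
    have := absRamificationIdx_pos p K
    rw [he] at this
    exact_mod_cast this
  -- `‖q‖ = ‖ϖ‖^m`
  have hqm : ‖q‖ = ‖(ϖ : K)‖ ^ (m : ℤ) := by
    have hq1 : ‖q‖ = (p : ℝ) ^ (-((H : ℝ) / D)) := norm_eq_rpow_of_pow_eq p hD.ne' hqD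
    rw [hq1, norm_unif_zpow_eq_rpow p hϖ, he]
    congr 1
    have hD0 : (0 : ℝ) < D := by exact_mod_cast hD
    have hmD : (m : ℝ) * D = e₀ * H := by exact_mod_cast hm
    field_simp
    push_cast
    linarith
  have hc : ((if p = 2 then 2 else 1 : ℕ) : ℤ) = 1 := by rw [if_neg hp2]; rfl
  refine not_mem_pow_smul_logShell_of_bracket p K hϖ hqm (N := (e₀ : ℤ) + (m : ℤ) * (1 - (n : ℤ)))
    (by rw [hc, he]; ring) (s₁ := (s₁ : ℤ)) (by exact_mod_cast hs₁) (a₁ := a₁) (a₂ := a₂) ?_ ?_ ?_ ?_ ?_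
  · rw [he]; exact hlow
  · intro a ha
    have h1 := hlo₂ a ha
    rw [he]
    have : (((s₁ + 1) * p ^ a * (p - 1) : ℕ) : ℤ) < (e₀ : ℤ) := by exact_mod_cast h1
    push_cast [Nat.cast_sub hp1] at this
    linarith
  · rw [he]
    have : (e₀ : ℤ) ≤ (((s₁ + 1) * p ^ a₂ * (p - 1) : ℕ) : ℤ) := by exact_mod_cast hhi₂
    push_cast [Nat.cast_sub hp1] at this
    linarith
  · rw [he]; linarith
  · rw [he]; exact htf

end General

/-! ## §4. R-H rows over `ℚ₇`: the HEX / `λ_k` local type `e = ev·l`, `‖q̲‖ = 7^{−k/l}`, label `j` -/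

section Seven

variable (K : Type*) [NontriviallyNormedField K] [NormedAlgebra ℚ_[7] K] [IsUltrametricDist K] [ProperSpace K]

/-- **HEX CELL, GAP-NEG (all row data literal).** `K/ℚ₇` of LOCAL TYPE `e(K) = ev·l` (hypothesis on the place, never asserted), `‖q‖ = 7^{−k/l}`
(`l ≥ 1`), label `j`; bracket `(s₁, a₁, a₂)` for `N = ev·l + ev·k·(1 − j²)` and a tie bound `A` (`ev·l < 7^A`, no `s·7ᵃ·6 = ev·l` with `a < A`,
`1 ≤ s ≤ s₁`) ⟹ **`q ∉ q^{j²} · ℐ_K`**. Every hypothesis after instantiation is a numeral (in)equality (`decide` / `norm_num`).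
[cite: MochizukiAbsTopIII2015, Def 5.4 (iii) p. 126] [claim: Mochizuki2012, status: disputed] -/
theorem hex_cell_neg_of_bracket {q : K} {k l ev j : ℕ} (hl : 0 < l) (he : absRamificationIdx 7 K = ev * l)
    (hq : ‖q‖ = (7 : ℝ) ^ (-((k : ℝ) / l))) {s₁ a₁ a₂ A : ℕ} (hs₁ : 1 ≤ s₁)
    (hlow : (s₁ : ℤ) * 7 ^ a₁ - ((ev * l : ℕ) : ℤ) * (a₁ : ℤ) < ((ev * l : ℕ) : ℤ) + ((ev * k : ℕ) : ℤ) * (1 - ((j ^ 2 : ℕ) : ℤ)))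
    (hlo₂ : ∀ a < a₂, (s₁ + 1) * 7 ^ a * 6 < ev * l) (hhi₂ : ev * l ≤ (s₁ + 1) * 7 ^ a₂ * 6)
    (hup : ((ev * l : ℕ) : ℤ) + ((ev * k : ℕ) : ℤ) * (1 - ((j ^ 2 : ℕ) : ℤ)) < ((s₁ : ℤ) + 1) * 7 ^ a₂ - ((ev * l : ℕ) : ℤ) * (a₂ : ℤ))
    (hA : ev * l < 7 ^ A) (htf : ∀ a < A, ∀ s ≤ s₁, 0 < s → s * 7 ^ a * 6 ≠ ev * l) :
    q ∉ q ^ (j ^ 2) • logShell (PadicLogOnUnits.ofUnitLog 7 K) := by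
  haveI : Fact (Nat.Prime 7) := ⟨by norm_num⟩
  have hqD : ‖q‖ ^ l = ((7 : ℕ) : ℝ) ^ (-(k : ℝ)) := by
    rw [hq, ← Real.rpow_natCast, ← Real.rpow_mul (by norm_num : (0 : ℝ) ≤ 7)]
    push_cast
    congr 1
    have hl0 : (l : ℝ) ≠ 0 := by exact_mod_cast hl.ne'
    field_simp
  have hA' : absRamificationIdx 7 K < 7 ^ A := he ▸ hA
  have htf' := tieFree_of_bounded 7 K hA' (S₁ := s₁) (fun a ha s hs hs0 => by rw [he]; exact htf a ha s hs hs0)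
  rw [he] at htf'
  exact not_mem_pow_smul_logShell_of_bracket_root 7 K (by norm_num) he hl hqD (m := ev * k) (by ring) hs₁
    (by exact_mod_cast hlow) hlo₂ hhi₂ (by exact_mod_cast hup) (fun s a h1 h2 => by exact_mod_cast htf' s a h1 h2)

/-- **HEX CELL, GAP-NEG, `6 ∤ ev·l`** (no tie possible; the bounded tie check is discharged). [claim: Mochizuki2012, status: disputed] -/
theorem hex_cell_neg_of_bracket_of_not_six_dvd {q : K} {k l ev j : ℕ} (hl : 0 < l) (he : absRamificationIdx 7 K = ev * l)
    (h6 : ¬ 6 ∣ ev * l) (hq : ‖q‖ = (7 : ℝ) ^ (-((k : ℝ) / l))) {s₁ a₁ a₂ : ℕ} (hs₁ : 1 ≤ s₁)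
    (hlow : (s₁ : ℤ) * 7 ^ a₁ - ((ev * l : ℕ) : ℤ) * (a₁ : ℤ) < ((ev * l : ℕ) : ℤ) + ((ev * k : ℕ) : ℤ) * (1 - ((j ^ 2 : ℕ) : ℤ)))
    (hlo₂ : ∀ a < a₂, (s₁ + 1) * 7 ^ a * 6 < ev * l) (hhi₂ : ev * l ≤ (s₁ + 1) * 7 ^ a₂ * 6)
    (hup : ((ev * l : ℕ) : ℤ) + ((ev * k : ℕ) : ℤ) * (1 - ((j ^ 2 : ℕ) : ℤ)) < ((s₁ : ℤ) + 1) * 7 ^ a₂ - ((ev * l : ℕ) : ℤ) * (a₂ : ℤ)) :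
    q ∉ q ^ (j ^ 2) • logShell (PadicLogOnUnits.ofUnitLog 7 K) := by
  haveI : Fact (Nat.Prime 7) := ⟨by norm_num⟩
  have hqD : ‖q‖ ^ l = ((7 : ℕ) : ℝ) ^ (-(k : ℝ)) := by
    rw [hq, ← Real.rpow_natCast, ← Real.rpow_mul (by norm_num : (0 : ℝ) ≤ 7)]
    push_cast
    congr 1
    have hl0 : (l : ℝ) ≠ 0 := by exact_mod_cast hl.ne'
    field_simp
  have hnd : ¬ (7 - 1) ∣ absRamificationIdx 7 K := by rw [he]; exact h6
  have htf' := tieFree_of_not_dvd 7 K hnd (s₁ : ℤ)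
  rw [he] at htf'
  exact not_mem_pow_smul_logShell_of_bracket_root 7 K (by norm_num) he hl hqD (m := ev * k) (by ring) hs₁
    (by exact_mod_cast hlow) hlo₂ hhi₂ (by exact_mod_cast hup) (fun s a h1 h2 => by exact_mod_cast htf' s a h1 h2)

end Seven

end Summit.ABC.IUTFork.Repair.CandInternal2RealGap

end
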